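import Summits.QuantumFields.BalabanUV.Beta.D1BFx.CoframeWordsKfive
import Summits.QuantumFields.BalabanUV.Beta.D1BFx.CompositeLegMasses

/-!
# `BalabanUV.Beta.D1BFx.CoframeWordsKfour` — road «BF-x» for binder row D1, slot (K), (II)-row (C2) «TB4-W CO-FRAME TABLE, m-UNIFORM MASS»,
# FILE δ3b «COFRAME WORDS k7 ∕ k4 ∕ TOTAL»: **THE `qW`- AND `l2W`-WORDS REGROUPED BY ASSOCIATIVITY SO THAT EVERY `(−Δ)` BINDS TO THE ADJACENT `Cgh`**
# (legs `lapU∘Cgh`, `Cgh∘lapU` `≍ n²`, `lapU∘Cgh∘lapU` `≍ n⁰` — never `(−Δ)` with the vertex, which would cost `n²`), their total masses, and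
# **`totMass_cofPairInf`**: the total mass of the whole co-frame pair table against abstract leg masses

HONEST DEPENDENCY (cell records, verbatim): «continuum YM on T⁴ ⇐ BetaPertH ∧ nine spine estimates (0/9 proved); BetaPertH ⇐ (D1) ∧ (D4) ∧
CAP+tail; G-an2-4 gates asym, D1 and NE2/3/4.»  HONEST FRAMING (cell contract, verbatim): «discharging `BetaPertH` makes Bałaban's UV stability
UNCONDITIONAL — a real constructive-QFT result; it is NOT the continuum limit and NOT the Clay problem.»  THIS MODULE DISCHARGES NOTHING of the
wall: [folklore] `TameKernelCalculus.comp_assoc_tame ∕ comp_add_left∕right_tame` over mass pairs (γ3 `tame_of_masses`), then δ1∕δ1b∕δ2∕δ3a.  No definition, no `def … : Prop`, nothing cited, 0 sorry.  0 root-level binders of row D1 discharged (hW ∕ hR-sockets ∕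
hSX-socket ∕ D1Tel ∕ D1Rep = 0); (K) NOT closed; (C1)(C2) NOT closed here; NOT D1, NOT `BetaPertH`, NOT continuum, NOT Clay.

ABSOLUTE RULE (cell charter, verbatim): «No internally-minted statement may enter as a cited fact. Every hypothesis is either kernel-proved in
this package or a verbatim quotation of a PUBLISHED theorem with page reference. The manuscript(s) under audit are NOT citable for their own
disputed steps — they are the thing under adjudication; programme-internal (2001/route/tribunal) claims are never citable.»

WHY.  `qW w = gW w∘lapU + lapU∘gW w` puts a bare `(−Δ)` next to a vertex; counted there it is `O(1)` and the neighbouring `Cgh` costs `n⁴`, one `n²`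
too many.  Regrouped (`k7_word1_eq`, `k7_word2_eq`, `k4_word1_eq`, `k4_word2_eq`) every `(−Δ)` joins a `Cgh` (`lapU∘Cgh ≍ n²`, `lapU∘Cgh∘lapU ≍ n⁰`,
γ3) and all sixteen words are `n⁰` at the road's weights (ledger W-1 l.43312; δ4a∕δ4b make it a theorem).

CONTENT (all [folklore]; `χ` = θ-mass of `lapU∘Cgh` and of `Cgh∘lapU`, `γ` of `Cgh`, `ψ` of `lapU∘Cgh∘lapU`, `r` of `Rgt`; weights as in δ3a).
* §1 `mp_comp ∕ mp_add ∕ mp_lapU ∕ tm` (mass pairs ⟹ tameness), `totMass_dSw_add`, `totMass_jetCw_add`.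
* §2 `mp_qW`, **`comp_qW`** (`A ∘ qW w = (A∘gW w)∘lapU + (A∘lapU)∘gW w`), **`k7_word1_eq`**, **`k7_word2_eq`**, **`k4_word1_eq`** (the `l2W` word = four
  words), **`k4_word2_eq`** (the `qW–qW` word = four sandwiches each followed by one leg).
* §3 `vertex_through`, **`totMass_k7Inf`**, **`totMass_k4a`**, **`totMass_k4b`**, **`totMass_k4Inf`**.
* §4 **`totMass_cofPairInf`**: `TotMass (cofPairInf n a w w′) (|2|·P(C, C′, e^δ, e^θ, χ, γ, ψ, r; Zl 4 (δ−θ), e^{−θ|P−P′|₁}))`, `P` an explicit polynomial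
  with ONE `Zl` and ONE separation factor in every monomial (generated together with δ4a's majorant; the two files must be regenerated together).
NOT HERE: the road instantiation and the n-free constant (δ4a `CoframeMassAlgebra`, δ4b `CoframeMassUniform`).
Unit `b2b-balaban-gan24-formalise-leaf-05` (gen 54), G-an2-4 swarm leaf prover 05, road «BF-x» (C1)(C2) count owner (OWNER RULING ρ-g19-1 AMENDED l.43347,
ρ-g19-2: the END's currency is the subsequence `n = L^k`); INTENT «COFRAME WORDS ∕ UNIFORM» (journal).
-/

noncomputable section

namespace Summit.QuantumFields.BalabanUV.Beta.D1BFx.CoframeWordsKfour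

open scoped BigOperators
open Finset
open Literature.MathematicalPhysics.QuantumFieldTheory.Balaban1983to89
open Literature.MathematicalPhysics.QuantumFieldTheory.Balaban1983to89.Beta
open B12Sec2to5 (l1 l1_nonneg)
open ExpKernelCalculus (Site MKer comp Zl Zl_pos l1_sub_triangle l1_sub_symm)
open AffineAveraging (unitVec)
open Summit.QuantumFields.BalabanUV.Beta.TameKernelCalculus (Tame trK trK_trK trK_comp comp_neg_left comp_assoc_tame comp_add_right_tame comp_add_left_tame)
open Summit.QuantumFields.BalabanUV.Beta.D1BFx.RJetAssembly (dSw)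
open Summit.QuantumFields.BalabanUV.Beta.D1BFx.PackedPinnedLetters (jetRw jetCw jetRCw)
open Summit.QuantumFields.BalabanUV.Beta.D1BFx.GhostStencil (l1_unitVec l1_zero)
open Summit.QuantumFields.BalabanUV.Beta.D1BFx.KGhostLeg (Cgh)
open Summit.QuantumFields.BalabanUV.Beta.D1BFx.RJetProjector (Rgt)
open Summit.QuantumFields.BalabanUV.Beta.D1BFx.TorusGhostWordArrays (lapU decays_lapU)
open Summit.QuantumFields.BalabanUV.Beta.D1BFx.PackedCoframeSiteWords (gW qW d2W)
open Summit.QuantumFields.BalabanUV.Beta.D1BFx.PackedCoframePairLimit (l2WInf k7Inf k4Inf)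
open Summit.QuantumFields.BalabanUV.Beta.D1BFx.KernelMassCalculus
open Summit.QuantumFields.BalabanUV.Beta.D1BFx.KernelMassTotal
open Summit.QuantumFields.BalabanUV.Beta.D1BFx.CoframeWordShapes
open Summit.QuantumFields.BalabanUV.Beta.D1BFx.CoframeWordPieces
open Summit.QuantumFields.BalabanUV.Beta.D1BFx.CoframeVertices
open Summit.QuantumFields.BalabanUV.Beta.D1BFx.CompositeLegMasses (tame_of_masses tame_lapU)

/-! ## §1 Bookkeeping: mass pairs, tameness, linearity of the shapes -/
section Book
variable {A B K Y₁ Y₂ : MKer 4 Unit} {MA MB M M₁ M₂ : ℝ}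

/-- [folklore] Mass pairs multiply. -/
theorem mp_comp (hA : RowMass A 0 MA ∧ ColMass A 0 MA) (hB : RowMass B 0 MB ∧ ColMass B 0 MB) :
    RowMass (comp A B) 0 (MA * MB) ∧ ColMass (comp A B) 0 (MA * MB) :=
  ⟨rowMass_comp hA.1 hB.1 le_rfl, colMass_comp hA.2 hB.2 le_rfl⟩

/-- [folklore] Mass pairs add. -/
theorem mp_add (hA : RowMass A 0 MA ∧ ColMass A 0 MA) (hB : RowMass B 0 MB ∧ ColMass B 0 MB) :
    RowMass (A + B) 0 (MA + MB) ∧ ColMass (A + B) 0 (MA + MB) :=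
  ⟨hA.1.add hB.1, hA.2.add hB.2⟩

/-- [folklore] The mass pair of `lapU` (from `decays_lapU`). -/
theorem mp_lapU : RowMass lapU 0 ((Fintype.card Unit : ℝ) ^ 2 * (16 * Real.exp 1) * Zl 4 (1 - 0)) ∧
    ColMass lapU 0 ((Fintype.card Unit : ℝ) ^ 2 * (16 * Real.exp 1) * Zl 4 (1 - 0)) :=
  rowMass_of_decays decays_lapU (by norm_num)

/-- [folklore] A mass pair makes a kernel tame. -/
theorem tm (h : RowMass K 0 M ∧ ColMass K 0 M) : Tame K := tame_of_masses h.1 h.2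

/-- [folklore] `dSw` of a sum, in total mass. -/
theorem totMass_dSw_add (h1 : TotMass Y₁ M₁) (h2 : TotMass Y₂ M₂) : TotMass (dSw (Y₁ + Y₂)) (64 * M₁ + 64 * M₂) := by
  have e : dSw (Y₁ + Y₂) = dSw Y₁ + dSw Y₂ := by
    funext x z α β; simp only [dSw, Pi.add_apply]; ring
  rw [e]; exact totMass_add (totMass_dSw h1) (totMass_dSw h2)

/-- [folklore] `jetCw ω` of a sum, in total mass. -/
theorem totMass_jetCw_add {ω : Fin 4 → Site 4 → ℝ} (h1 : TotMass (jetCw ω Y₁) M₁) (h2 : TotMass (jetCw ω Y₂) M₂) :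
    TotMass (jetCw ω (Y₁ + Y₂)) (M₁ + M₂) := by
  have e : jetCw ω (Y₁ + Y₂) = jetCw ω Y₁ + jetCw ω Y₂ := by
    funext x z α β; simp only [jetCw, Pi.add_apply]; ring
  rw [e]; exact totMass_add h1 h2

end Book

/-! ## §2 Regrouping the `qW`- and `l2W`-words -/
section Regroup
variable {n : ℕ} [NeZero n] {a : ℝ} {w w' : Fin 4 → Site 4 → ℝ} {ωV ωV' χ₀ χ₀' γ₀ md MA : ℝ} {A : MKer 4 Unit}

/-- [folklore] The mass pair of `qW w`. -/
theorem mp_qW (hV : RowMass (gW w) 0 ωV ∧ ColMass (gW w) 0 ωV) :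
    RowMass (qW w) 0 (ωV * ((Fintype.card Unit : ℝ) ^ 2 * (16 * Real.exp 1) * Zl 4 (1 - 0))
      + ((Fintype.card Unit : ℝ) ^ 2 * (16 * Real.exp 1) * Zl 4 (1 - 0)) * ωV) ∧
    ColMass (qW w) 0 (ωV * ((Fintype.card Unit : ℝ) ^ 2 * (16 * Real.exp 1) * Zl 4 (1 - 0))
      + ((Fintype.card Unit : ℝ) ^ 2 * (16 * Real.exp 1) * Zl 4 (1 - 0)) * ωV) := by
  rw [qW]; exact mp_add (mp_comp hV mp_lapU) (mp_comp mp_lapU hV)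

/-- [folklore] **A LEG AGAINST `qW w`**: `A ∘ qW w = (A ∘ gW w) ∘ lapU + (A ∘ lapU) ∘ gW w`. -/
theorem comp_qW (hA : RowMass A 0 MA ∧ ColMass A 0 MA) (hV : RowMass (gW w) 0 ωV ∧ ColMass (gW w) 0 ωV) :
    comp A (qW w) = comp (comp A (gW w)) lapU + comp (comp A lapU) (gW w) := by
  rw [qW, comp_add_right_tame (tm hA) (tm (mp_comp hV mp_lapU)) (tm (mp_comp mp_lapU hV)), comp_assoc_tame (tm hA) (tm hV) (tm mp_lapU),
    comp_assoc_tame (tm hA) (tm mp_lapU) (tm hV)]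

/-- [folklore] **THE FIRST `k7` WORD REGROUPED**: `(lapU∘Cgh) ∘ qW w ∘ Cgh ∘ gW w′ = ((lapU∘Cgh)∘gW w) ∘ (lapU∘Cgh) ∘ gW w′ + ((lapU∘Cgh∘lapU)∘gW w) ∘ Cgh ∘ gW w′`. -/
theorem k7_word1_eq (hV : RowMass (gW w) 0 ωV ∧ ColMass (gW w) 0 ωV) (hV' : RowMass (gW w') 0 ωV' ∧ ColMass (gW w') 0 ωV')
    (hLC : RowMass (comp lapU (Cgh n a)) 0 χ₀ ∧ ColMass (comp lapU (Cgh n a)) 0 χ₀) (hC : RowMass (Cgh n a) 0 γ₀ ∧ ColMass (Cgh n a) 0 γ₀) :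
    comp (comp (comp (comp lapU (Cgh n a)) (qW w)) (Cgh n a)) (gW w')
      = comp (comp (comp (comp lapU (Cgh n a)) (gW w)) (comp lapU (Cgh n a))) (gW w')
        + comp (comp (comp (comp (comp lapU (Cgh n a)) lapU) (gW w)) (Cgh n a)) (gW w') := by
  have hVt := mp_comp hLC hV
  have hY := mp_comp hLC mp_lapU
  rw [comp_qW hLC hV, comp_add_left_tame (tm (mp_comp hVt mp_lapU)) (tm (mp_comp hY hV)) (tm hC),
    ← comp_assoc_tame (tm hVt) (tm mp_lapU) (tm hC),
    comp_add_left_tame (tm (mp_comp hVt hLC)) (tm (mp_comp (mp_comp hY hV) hC)) (tm hV')]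

/-- [folklore] **THE SECOND `k7` WORD REGROUPED**: `(lapU∘Cgh) ∘ qW w ∘ (Cgh∘lapU) = ((lapU∘Cgh)∘gW w) ∘ (lapU∘Cgh∘lapU) + ((lapU∘Cgh∘lapU)∘gW w) ∘ (Cgh∘lapU)`. -/
theorem k7_word2_eq (hV : RowMass (gW w) 0 ωV ∧ ColMass (gW w) 0 ωV)
    (hLC : RowMass (comp lapU (Cgh n a)) 0 χ₀ ∧ ColMass (comp lapU (Cgh n a)) 0 χ₀) (hCL : RowMass (comp (Cgh n a) lapU) 0 χ₀' ∧ ColMass (comp (Cgh n a) lapU) 0 χ₀')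
    (hC : RowMass (Cgh n a) 0 γ₀ ∧ ColMass (Cgh n a) 0 γ₀) :
    comp (comp (comp lapU (Cgh n a)) (qW w)) (comp (Cgh n a) lapU)
      = comp (comp (comp lapU (Cgh n a)) (gW w)) (comp (comp lapU (Cgh n a)) lapU)
        + comp (comp (comp (comp lapU (Cgh n a)) lapU) (gW w)) (comp (Cgh n a) lapU) := by
  have hVt := mp_comp hLC hV
  have hY := mp_comp hLC mp_lapU
  rw [comp_qW hLC hV, comp_add_left_tame (tm (mp_comp hVt mp_lapU)) (tm (mp_comp hY hV)) (tm hCL),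
    ← comp_assoc_tame (tm hVt) (tm mp_lapU) (tm hCL), comp_assoc_tame (tm mp_lapU) (tm hC) (tm mp_lapU)]

/-- [folklore] **THE `l2W` WORD REGROUPED**: `(lapU∘Cgh) ∘ l2WInf w w′ ∘ (Cgh∘lapU)` = four words, each `(−Δ)` bound to a `Cgh`. -/
theorem k4_word1_eq (hV : RowMass (gW w) 0 ωV ∧ ColMass (gW w) 0 ωV) (hV' : RowMass (gW w') 0 ωV' ∧ ColMass (gW w') 0 ωV')
    (hLC : RowMass (comp lapU (Cgh n a)) 0 χ₀ ∧ ColMass (comp lapU (Cgh n a)) 0 χ₀) (hCL : RowMass (comp (Cgh n a) lapU) 0 χ₀' ∧ ColMass (comp (Cgh n a) lapU) 0 χ₀')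
    (hC : RowMass (Cgh n a) 0 γ₀ ∧ ColMass (Cgh n a) 0 γ₀) (hd : RowMass (d2W w w') 0 md ∧ ColMass (d2W w w') 0 md) :
    comp (comp (comp lapU (Cgh n a)) (l2WInf w w')) (comp (Cgh n a) lapU)
      = comp (comp (comp lapU (Cgh n a)) (d2W w w')) (comp (comp lapU (Cgh n a)) lapU)
        + comp (comp (comp (comp lapU (Cgh n a)) (gW w)) (gW w')) (comp (Cgh n a) lapU)
        + comp (comp (comp (comp lapU (Cgh n a)) (gW w')) (gW w)) (comp (Cgh n a) lapU)
        + comp (comp (comp (comp lapU (Cgh n a)) lapU) (d2W w w')) (comp (Cgh n a) lapU) := by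
  have hY := mp_comp hLC mp_lapU
  have ha := mp_comp hd mp_lapU
  have hb := mp_comp hV hV'
  have hc := mp_comp hV' hV
  have hdd := mp_comp mp_lapU hd
  rw [l2WInf, comp_add_right_tame (tm hLC) (tm (mp_add (mp_add ha hb) hc)) (tm hdd),
    comp_add_right_tame (tm hLC) (tm (mp_add ha hb)) (tm hc), comp_add_right_tame (tm hLC) (tm ha) (tm hb),
    comp_assoc_tame (tm hLC) (tm hd) (tm mp_lapU), comp_assoc_tame (tm hLC) (tm hV) (tm hV'), comp_assoc_tame (tm hLC) (tm hV') (tm hV),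
    comp_assoc_tame (tm hLC) (tm mp_lapU) (tm hd)]
  have h1 := mp_comp (mp_comp hLC hd) mp_lapU
  have h2 := mp_comp (mp_comp hLC hV) hV'
  have h3 := mp_comp (mp_comp hLC hV') hV
  have h4 := mp_comp hY hd
  rw [comp_add_left_tame (tm (mp_add (mp_add h1 h2) h3)) (tm h4) (tm hCL), comp_add_left_tame (tm (mp_add h1 h2)) (tm h3) (tm hCL),
    comp_add_left_tame (tm h1) (tm h2) (tm hCL), ← comp_assoc_tame (tm (mp_comp hLC hd)) (tm mp_lapU) (tm hCL),
    comp_assoc_tame (tm mp_lapU) (tm hC) (tm mp_lapU)]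

/-- [folklore] **THE `qW–qW` WORD REGROUPED**: `(lapU∘Cgh) ∘ qW w ∘ Cgh ∘ qW w′ ∘ (Cgh∘lapU)` = four sandwiches, each followed by one leg. -/
theorem k4_word2_eq (hV : RowMass (gW w) 0 ωV ∧ ColMass (gW w) 0 ωV) (hV' : RowMass (gW w') 0 ωV' ∧ ColMass (gW w') 0 ωV')
    (hLC : RowMass (comp lapU (Cgh n a)) 0 χ₀ ∧ ColMass (comp lapU (Cgh n a)) 0 χ₀) (hCL : RowMass (comp (Cgh n a) lapU) 0 χ₀' ∧ ColMass (comp (Cgh n a) lapU) 0 χ₀')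
    (hC : RowMass (Cgh n a) 0 γ₀ ∧ ColMass (Cgh n a) 0 γ₀) :
    comp (comp (comp (comp (comp lapU (Cgh n a)) (qW w)) (Cgh n a)) (qW w')) (comp (Cgh n a) lapU)
      = comp (comp (comp (comp (comp lapU (Cgh n a)) (gW w)) (comp lapU (Cgh n a))) (gW w')) (comp (comp lapU (Cgh n a)) lapU)
        + comp (comp (comp (comp (comp lapU (Cgh n a)) (gW w)) (comp (comp lapU (Cgh n a)) lapU)) (gW w')) (comp (Cgh n a) lapU)
        + (comp (comp (comp (comp (comp (comp lapU (Cgh n a)) lapU) (gW w)) (Cgh n a)) (gW w')) (comp (comp lapU (Cgh n a)) lapU)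
          + comp (comp (comp (comp (comp (comp lapU (Cgh n a)) lapU) (gW w)) (comp (Cgh n a) lapU)) (gW w')) (comp (Cgh n a) lapU)) := by
  have hY := mp_comp hLC mp_lapU
  have hVt := mp_comp hLC hV
  have hVh := mp_comp hY hV
  have hqW' := mp_qW hV'
  -- steps 1–2: `(LC ∘ qW w) ∘ C = Ṽ ∘ LC + V̂ ∘ C`
  rw [comp_qW hLC hV, comp_add_left_tame (tm (mp_comp hVt mp_lapU)) (tm hVh) (tm hC), ← comp_assoc_tame (tm hVt) (tm mp_lapU) (tm hC)]
  -- step 3: against `qW w′`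
  rw [comp_add_left_tame (tm (mp_comp hVt hLC)) (tm (mp_comp hVh hC)) (tm hqW'), comp_qW (mp_comp hVt hLC) hV', comp_qW (mp_comp hVh hC) hV',
    ← comp_assoc_tame (tm hVt) (tm hLC) (tm mp_lapU), ← comp_assoc_tame (tm hVh) (tm hC) (tm mp_lapU)]
  -- step 4: against `Cgh ∘ lapU`
  have t1 := mp_comp (mp_comp (mp_comp hVt hLC) hV') mp_lapU
  have t2 := mp_comp (mp_comp hVt hY) hV'
  have t3 := mp_comp (mp_comp (mp_comp hVh hC) hV') mp_lapU
  have t4 := mp_comp (mp_comp hVh hCL) hV'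
  rw [comp_add_left_tame (tm (mp_add t1 t2)) (tm (mp_add t3 t4)) (tm hCL), comp_add_left_tame (tm t1) (tm t2) (tm hCL),
    comp_add_left_tame (tm t3) (tm t4) (tm hCL), ← comp_assoc_tame (tm (mp_comp (mp_comp hVt hLC) hV')) (tm mp_lapU) (tm hCL),
    ← comp_assoc_tame (tm (mp_comp (mp_comp hVh hC) hV')) (tm mp_lapU) (tm hCL), comp_assoc_tame (tm mp_lapU) (tm hC) (tm mp_lapU)]

end Regroup

/-! ## §3 The total masses of `k7Inf` and `k4Inf` -/
section Masses
open Summit.QuantumFields.BalabanUV.Beta.D1BFx.CoframeWordsKfive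

variable {n : ℕ} [NeZero n] {a : ℝ} {w w' : Fin 4 → Site 4 → ℝ} {C C' δ θ χ χ γ ψ : ℝ} {P P' : Site 4}

/-- [folklore] The vertex `(lapU∘Cgh) ∘ gW w` (a leg on the far side of the packed current): row mass and localised columns, `× χ₀`. -/
theorem vertex_through {A : MKer 4 Unit} {cA : ℝ} (hw : ∀ κ u, |w κ u| ≤ C * Real.exp (-δ * l1 (u - P))) (hδ : 0 ≤ δ)
    (hA : RowMass A 0 cA ∧ ColMass A 0 cA) :
    RowMass (comp A (gW w)) 0 (cA * (8 * C * Real.exp δ)) ∧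
      ∀ y, (Summable fun u => rowFn (comp A (gW w)) 0 u y) ∧
        ∑' u, rowFn (comp A (gW w)) 0 u y ≤ cA * (8 * C * Real.exp δ) * Real.exp (-δ * l1 (y - P)) :=
  ⟨rowMass_comp hA.1 (masses_gW hw hδ).1 le_rfl, fun y =>
    ⟨(cols_comp_left hA.2 (cols_gW hw hδ) y).1, (cols_comp_left hA.2 (cols_gW hw hδ) y).2.trans_eq (by ring)⟩⟩

/-- [folklore] **THE TOTAL MASS OF `k7Inf n a w w′`** against θ-masses `χ` of `lapU∘Cgh` and of `Cgh∘lapU`, `γ` of `Cgh`, `ψ` of `lapU∘Cgh∘lapU`. -/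
theorem totMass_k7Inf (hw : ∀ κ u, |w κ u| ≤ C * Real.exp (-δ * l1 (u - P))) (hw' : ∀ κ u, |w' κ u| ≤ C' * Real.exp (-δ * l1 (u - P')))
    (hθ : 0 ≤ θ) (hθδ : θ < δ) (hX : RowMass (comp lapU (Cgh n a)) θ χ ∧ ColMass (comp lapU (Cgh n a)) θ χ)
    (hXt : RowMass (comp (Cgh n a) lapU) θ χ ∧ ColMass (comp (Cgh n a) lapU) θ χ) (hC : RowMass (Cgh n a) θ γ ∧ ColMass (Cgh n a) θ γ)
    (hY : RowMass (comp (comp lapU (Cgh n a)) lapU) θ ψ ∧ ColMass (comp (comp lapU (Cgh n a)) lapU) θ ψ) :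
    TotMass (k7Inf n a w w')
      ((64 * ((χ * (8 * C * Real.exp δ)) * (8 * C' * Real.exp δ) * χ * Zl 4 (δ - θ) * Real.exp (-θ * l1 (P - P')))
        + 64 * ((ψ * (8 * C * Real.exp δ)) * (8 * C' * Real.exp δ) * γ * Zl 4 (δ - θ) * Real.exp (-θ * l1 (P - P'))))
      + (32 * ((χ * (8 * C * Real.exp δ)) * C' * (Real.exp θ * ψ) * Zl 4 (δ - θ) * Real.exp (-θ * l1 (P - P')))
        + 32 * ((ψ * (8 * C * Real.exp δ)) * C' * (Real.exp θ * χ) * Zl 4 (δ - θ) * Real.exp (-θ * l1 (P - P'))))) := by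
  have hδ : 0 ≤ δ := hθ.trans hθδ.le
  have hV := masses_gW hw hδ
  have hV' := masses_gW hw' hδ
  have hX0 : RowMass (comp lapU (Cgh n a)) 0 χ ∧ ColMass (comp lapU (Cgh n a)) 0 χ := ⟨hX.1.mono hθ le_rfl, hX.2.mono hθ le_rfl⟩
  have hXt0 : RowMass (comp (Cgh n a) lapU) 0 χ ∧ ColMass (comp (Cgh n a) lapU) 0 χ := ⟨hXt.1.mono hθ le_rfl, hXt.2.mono hθ le_rfl⟩
  have hC0 : RowMass (Cgh n a) 0 γ ∧ ColMass (Cgh n a) 0 γ := ⟨hC.1.mono hθ le_rfl, hC.2.mono hθ le_rfl⟩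
  have hY0 : RowMass (comp (comp lapU (Cgh n a)) lapU) 0 ψ ∧ ColMass (comp (comp lapU (Cgh n a)) lapU) 0 ψ :=
    ⟨hY.1.mono hθ le_rfl, hY.2.mono hθ le_rfl⟩
  obtain ⟨hVtr, hVtc⟩ := vertex_through hw hδ hX0
  obtain ⟨hVhr, hVhc⟩ := vertex_through hw hδ hY0
  -- (7a) the two sandwiches
  have W1 := totMass_sandwich hVtr hVtc hX.1 hθ hθδ hV'.2 (rows_gW hw' hδ)
  have W2 := totMass_sandwich hVhr hVhc hC.1 hθ hθδ hV'.2 (rows_gW hw' hδ)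
  -- (7b) the two pieces «opposite sides»
  have U1 : TotMass (jetCw w' (comp (comp (comp lapU (Cgh n a)) (gW w)) (comp (comp lapU (Cgh n a)) lapU)))
      (32 * ((χ * (8 * C * Real.exp δ)) * C' * (Real.exp θ * ψ) * Zl 4 (δ - θ) * Real.exp (-θ * l1 (P - P')))) := by
    refine totMass_jetCw_of_pieces fun β s => ?_
    have h := totMass_piece_opp hVtr hVtc hY.1 hθ hθδ (hw' β) s (unitVec β)
    rw [l1_unitVec, mul_one] at h
    exact h
  have U2 : TotMass (jetCw w' (comp (comp (comp (comp lapU (Cgh n a)) lapU) (gW w)) (comp (Cgh n a) lapU)))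
      (32 * ((ψ * (8 * C * Real.exp δ)) * C' * (Real.exp θ * χ) * Zl 4 (δ - θ) * Real.exp (-θ * l1 (P - P')))) := by
    refine totMass_jetCw_of_pieces fun β s => ?_
    have h := totMass_piece_opp hVhr hVhc hXt.1 hθ hθδ (hw' β) s (unitVec β)
    rw [l1_unitVec, mul_one] at h
    exact h
  unfold k7Inf
  rw [k7_word1_eq hV hV' hX0 hC0, k7_word2_eq hV hX0 hXt0 hC0]
  exact totMass_add (totMass_neg (totMass_dSw_add W1 W2)) (totMass_jetCw_add U1 U2)

/-- [folklore] **THE `l2W` WORD**: `TotMass (dSw ((lapU∘Cgh) ∘ l2WInf w w′ ∘ (Cgh∘lapU))) (64·(Q1 + Q2 + Q3 + Q4))`. -/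
theorem totMass_k4a (hw : ∀ κ u, |w κ u| ≤ C * Real.exp (-δ * l1 (u - P))) (hw' : ∀ κ u, |w' κ u| ≤ C' * Real.exp (-δ * l1 (u - P')))
    (hθ : 0 ≤ θ) (hθδ : θ < δ) (hX : RowMass (comp lapU (Cgh n a)) θ χ ∧ ColMass (comp lapU (Cgh n a)) θ χ)
    (hXt : RowMass (comp (Cgh n a) lapU) θ χ ∧ ColMass (comp (Cgh n a) lapU) θ χ) (hC : RowMass (Cgh n a) θ γ ∧ ColMass (Cgh n a) θ γ)
    (hY : RowMass (comp (comp lapU (Cgh n a)) lapU) θ ψ ∧ ColMass (comp (comp lapU (Cgh n a)) lapU) θ ψ) :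
    TotMass (dSw (comp (comp (comp lapU (Cgh n a)) (l2WInf w w')) (comp (Cgh n a) lapU)))
      (64 * (χ * (8 * ((C * C') * Zl 4 (δ - θ) * Real.exp (-θ * l1 (P - P')))) * ψ
        + (χ * (8 * C * Real.exp δ)) * (8 * C' * Real.exp δ) * Zl 4 (δ - θ) * Real.exp (-θ * l1 (P - P')) * χ
        + (χ * (8 * C' * Real.exp δ)) * (8 * C * Real.exp δ) * Zl 4 (δ - θ) * Real.exp (-θ * l1 (P - P')) * χ
        + ψ * (8 * ((C * C') * Zl 4 (δ - θ) * Real.exp (-θ * l1 (P - P')))) * χ)) := by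
  have hδ : 0 ≤ δ := hθ.trans hθδ.le
  have hV := masses_gW hw hδ
  have hV' := masses_gW hw' hδ
  have hX0 : RowMass (comp lapU (Cgh n a)) 0 χ ∧ ColMass (comp lapU (Cgh n a)) 0 χ := ⟨hX.1.mono hθ le_rfl, hX.2.mono hθ le_rfl⟩
  have hXt0 : RowMass (comp (Cgh n a) lapU) 0 χ ∧ ColMass (comp (Cgh n a) lapU) 0 χ := ⟨hXt.1.mono hθ le_rfl, hXt.2.mono hθ le_rfl⟩
  have hC0 : RowMass (Cgh n a) 0 γ ∧ ColMass (Cgh n a) 0 γ := ⟨hC.1.mono hθ le_rfl, hC.2.mono hθ le_rfl⟩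
  have hY0 : RowMass (comp (comp lapU (Cgh n a)) lapU) 0 ψ ∧ ColMass (comp (comp lapU (Cgh n a)) lapU) 0 ψ :=
    ⟨hY.1.mono hθ le_rfl, hY.2.mono hθ le_rfl⟩
  have hd := totMass_d2W hw hw' hθ hθδ
  have hd0 : RowMass (d2W w w') 0 _ ∧ ColMass (d2W w w') 0 _ := ⟨totMass_rowMass hd, totMass_colMass hd⟩
  obtain ⟨hVtr, hVtc⟩ := vertex_through hw hδ hX0
  obtain ⟨hVtr', hVtc'⟩ := vertex_through hw' hδ hX0
  have Q1 := totMass_comp_right (totMass_comp_left hX0.2 hd) hY0.1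
  have Q2 := totMass_comp_right (totMass_touch hVtr hVtc hθ hθδ hV'.2 (rows_gW hw' hδ)) hXt0.1
  have Q3 := totMass_comp_right (totMass_touch hVtr' hVtc' hθ hθδ hV.2 (rows_gW hw hδ)) hXt0.1
  rw [l1_sub_symm] at Q3
  have Q4 := totMass_comp_right (totMass_comp_left hY0.2 hd) hXt0.1
  rw [k4_word1_eq hV hV' hX0 hXt0 hC0 hd0]
  exact totMass_dSw (totMass_add (totMass_add (totMass_add Q1 Q2) Q3) Q4)

/-- [folklore] **THE `qW–qW` WORD**: `TotMass (dSw ((lapU∘Cgh) ∘ qW w ∘ Cgh ∘ qW w′ ∘ (Cgh∘lapU))) (64·((T1 + T2) + (T3 + T4)))`. -/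
theorem totMass_k4b (hw : ∀ κ u, |w κ u| ≤ C * Real.exp (-δ * l1 (u - P))) (hw' : ∀ κ u, |w' κ u| ≤ C' * Real.exp (-δ * l1 (u - P')))
    (hθ : 0 ≤ θ) (hθδ : θ < δ) (hX : RowMass (comp lapU (Cgh n a)) θ χ ∧ ColMass (comp lapU (Cgh n a)) θ χ)
    (hXt : RowMass (comp (Cgh n a) lapU) θ χ ∧ ColMass (comp (Cgh n a) lapU) θ χ) (hC : RowMass (Cgh n a) θ γ ∧ ColMass (Cgh n a) θ γ)
    (hY : RowMass (comp (comp lapU (Cgh n a)) lapU) θ ψ ∧ ColMass (comp (comp lapU (Cgh n a)) lapU) θ ψ) :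
    TotMass (dSw (comp (comp (comp (comp (comp lapU (Cgh n a)) (qW w)) (Cgh n a)) (qW w')) (comp (Cgh n a) lapU)))
      (64 * (((χ * (8 * C * Real.exp δ)) * (8 * C' * Real.exp δ) * χ * Zl 4 (δ - θ) * Real.exp (-θ * l1 (P - P')) * ψ
          + (χ * (8 * C * Real.exp δ)) * (8 * C' * Real.exp δ) * ψ * Zl 4 (δ - θ) * Real.exp (-θ * l1 (P - P')) * χ)
        + ((ψ * (8 * C * Real.exp δ)) * (8 * C' * Real.exp δ) * γ * Zl 4 (δ - θ) * Real.exp (-θ * l1 (P - P')) * ψ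
          + (ψ * (8 * C * Real.exp δ)) * (8 * C' * Real.exp δ) * χ * Zl 4 (δ - θ) * Real.exp (-θ * l1 (P - P')) * χ))) := by
  have hδ : 0 ≤ δ := hθ.trans hθδ.le
  have hV := masses_gW hw hδ
  have hV' := masses_gW hw' hδ
  have hX0 : RowMass (comp lapU (Cgh n a)) 0 χ ∧ ColMass (comp lapU (Cgh n a)) 0 χ := ⟨hX.1.mono hθ le_rfl, hX.2.mono hθ le_rfl⟩
  have hXt0 : RowMass (comp (Cgh n a) lapU) 0 χ ∧ ColMass (comp (Cgh n a) lapU) 0 χ := ⟨hXt.1.mono hθ le_rfl, hXt.2.mono hθ le_rfl⟩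
  have hC0 : RowMass (Cgh n a) 0 γ ∧ ColMass (Cgh n a) 0 γ := ⟨hC.1.mono hθ le_rfl, hC.2.mono hθ le_rfl⟩
  have hY0 : RowMass (comp (comp lapU (Cgh n a)) lapU) 0 ψ ∧ ColMass (comp (comp lapU (Cgh n a)) lapU) 0 ψ :=
    ⟨hY.1.mono hθ le_rfl, hY.2.mono hθ le_rfl⟩
  obtain ⟨hVtr, hVtc⟩ := vertex_through hw hδ hX0
  obtain ⟨hVhr, hVhc⟩ := vertex_through hw hδ hY0
  have T1 := totMass_comp_right (totMass_sandwich hVtr hVtc hX.1 hθ hθδ hV'.2 (rows_gW hw' hδ)) hY0.1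
  have T2 := totMass_comp_right (totMass_sandwich hVtr hVtc hY.1 hθ hθδ hV'.2 (rows_gW hw' hδ)) hXt0.1
  have T3 := totMass_comp_right (totMass_sandwich hVhr hVhc hC.1 hθ hθδ hV'.2 (rows_gW hw' hδ)) hY0.1
  have T4 := totMass_comp_right (totMass_sandwich hVhr hVhc hXt.1 hθ hθδ hV'.2 (rows_gW hw' hδ)) hXt0.1
  rw [k4_word2_eq hV hV' hX0 hXt0 hC0]
  exact totMass_dSw (totMass_add (totMass_add T1 T2) (totMass_add T3 T4))

/-- [folklore] **THE TOTAL MASS OF `k4Inf n a w w′`**. -/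
theorem totMass_k4Inf (hw : ∀ κ u, |w κ u| ≤ C * Real.exp (-δ * l1 (u - P))) (hw' : ∀ κ u, |w' κ u| ≤ C' * Real.exp (-δ * l1 (u - P')))
    (hθ : 0 ≤ θ) (hθδ : θ < δ) (hX : RowMass (comp lapU (Cgh n a)) θ χ ∧ ColMass (comp lapU (Cgh n a)) θ χ)
    (hXt : RowMass (comp (Cgh n a) lapU) θ χ ∧ ColMass (comp (Cgh n a) lapU) θ χ) (hC : RowMass (Cgh n a) θ γ ∧ ColMass (Cgh n a) θ γ)
    (hY : RowMass (comp (comp lapU (Cgh n a)) lapU) θ ψ ∧ ColMass (comp (comp lapU (Cgh n a)) lapU) θ ψ) :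
    TotMass (k4Inf n a w w')
      (64 * (χ * (8 * ((C * C') * Zl 4 (δ - θ) * Real.exp (-θ * l1 (P - P')))) * ψ
          + (χ * (8 * C * Real.exp δ)) * (8 * C' * Real.exp δ) * Zl 4 (δ - θ) * Real.exp (-θ * l1 (P - P')) * χ
          + (χ * (8 * C' * Real.exp δ)) * (8 * C * Real.exp δ) * Zl 4 (δ - θ) * Real.exp (-θ * l1 (P - P')) * χ
          + ψ * (8 * ((C * C') * Zl 4 (δ - θ) * Real.exp (-θ * l1 (P - P')))) * χ)
        + 64 * (((χ * (8 * C * Real.exp δ)) * (8 * C' * Real.exp δ) * χ * Zl 4 (δ - θ) * Real.exp (-θ * l1 (P - P')) * ψ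
            + (χ * (8 * C * Real.exp δ)) * (8 * C' * Real.exp δ) * ψ * Zl 4 (δ - θ) * Real.exp (-θ * l1 (P - P')) * χ)
          + ((ψ * (8 * C * Real.exp δ)) * (8 * C' * Real.exp δ) * γ * Zl 4 (δ - θ) * Real.exp (-θ * l1 (P - P')) * ψ
            + (ψ * (8 * C * Real.exp δ)) * (8 * C' * Real.exp δ) * χ * Zl 4 (δ - θ) * Real.exp (-θ * l1 (P - P')) * χ))
        + 64 * (((χ * (8 * C' * Real.exp δ)) * (8 * C * Real.exp δ) * χ * Zl 4 (δ - θ) * Real.exp (-θ * l1 (P - P')) * ψ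
            + (χ * (8 * C' * Real.exp δ)) * (8 * C * Real.exp δ) * ψ * Zl 4 (δ - θ) * Real.exp (-θ * l1 (P - P')) * χ)
          + ((ψ * (8 * C' * Real.exp δ)) * (8 * C * Real.exp δ) * γ * Zl 4 (δ - θ) * Real.exp (-θ * l1 (P - P')) * ψ
            + (ψ * (8 * C' * Real.exp δ)) * (8 * C * Real.exp δ) * χ * Zl 4 (δ - θ) * Real.exp (-θ * l1 (P - P')) * χ))) := by
  have h3 := totMass_k4b hw' hw hθ hθδ hX hXt hC hY
  rw [l1_sub_symm] at h3
  unfold k4Inf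
  exact totMass_add (totMass_add (totMass_neg (totMass_k4a hw hw' hθ hθδ hX hXt hC hY)) (totMass_k4b hw hw' hθ hθδ hX hXt hC hY)) h3

end Masses

/-! ## §4 The total mass of `cofPairInf` against abstract leg masses -/
section Total
open Summit.QuantumFields.BalabanUV.Beta.D1BFx.CoframeWordsKfive
open Summit.QuantumFields.BalabanUV.Beta.D1BFx.PackedCoframePairLimit (k9Inf k5Inf cofPairInf)

variable {n : ℕ} [NeZero n] {a : ℝ} {w w' : Fin 4 → Site 4 → ℝ} {C C' δ θ χ γ ψ r : ℝ} {P P' : Site 4}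

/-- [folklore] **«COFRAME-MASS, ABSTRACT»: THE TOTAL MASS OF `cofPairInf n a w w′`** for weights localised at `P`, `P′` (amplitudes `C`, `C′`, rate `δ`)
against θ-masses `χ` (`lapU∘Cgh` and `Cgh∘lapU`), `γ` (`Cgh`), `ψ` (`lapU∘Cgh∘lapU`), `r` (`Rgt`), `0 ≤ θ < δ`: an explicit polynomial in the
letters with `Zl 4 (δ−θ)·e^{−θ|P−P′|₁}` in every monomial (nine tables; the transposed ones by `totMass_trK`, the swapped ones by `P ↔ P′`). -/
theorem totMass_cofPairInf (hw : ∀ κ u, |w κ u| ≤ C * Real.exp (-δ * l1 (u - P))) (hw' : ∀ κ u, |w' κ u| ≤ C' * Real.exp (-δ * l1 (u - P')))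
    (hθ : 0 ≤ θ) (hθδ : θ < δ) (hX : RowMass (comp lapU (Cgh n a)) θ χ ∧ ColMass (comp lapU (Cgh n a)) θ χ)
    (hXt : RowMass (comp (Cgh n a) lapU) θ χ ∧ ColMass (comp (Cgh n a) lapU) θ χ) (hC : RowMass (Cgh n a) θ γ ∧ ColMass (Cgh n a) θ γ)
    (hY : RowMass (comp (comp lapU (Cgh n a)) lapU) θ ψ ∧ ColMass (comp (comp lapU (Cgh n a)) lapU) θ ψ)
    (hR : RowMass (Rgt n a) θ r ∧ ColMass (Rgt n a) θ r) :
    TotMass (cofPairInf n a w w')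
      (|(2 : ℝ)| * (
        (64 * (χ * (8 * ((C * C') * Zl 4 (δ - θ) * Real.exp (-θ * l1 (P - P'))))) + 32 * (χ * (8 * C * Real.exp δ) * Real.exp δ * C' * Zl 4 (δ - θ) * Real.exp (-θ * l1 (P -
          P'))) + 32 * (χ * (8 * C' * Real.exp δ) * Real.exp δ * C * Zl 4 (δ - θ) * Real.exp (-θ * l1 (P - P'))) + 32 * (r * ((C * C') * Zl 4 (δ - θ) * Real.exp (-θ * l1 (P -
          P'))))) + ((64 * ((χ * (8 * C' * Real.exp δ)) * (8 * C * Real.exp δ) * χ * Zl 4 (δ - θ) * Real.exp (-θ * l1 (P - P'))) + 64 * ((ψ * (8 * C' * Real.exp δ)) * (8 * C *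
          Real.exp δ) * γ * Zl 4 (δ - θ) * Real.exp (-θ * l1 (P - P')))) + (32 * ((χ * (8 * C' * Real.exp δ)) * C * (Real.exp θ * ψ) * Zl 4 (δ - θ) * Real.exp (-θ * l1 (P -
          P'))) + 32 * ((ψ * (8 * C' * Real.exp δ)) * C * (Real.exp θ * χ) * Zl 4 (δ - θ) * Real.exp (-θ * l1 (P - P'))))) + ((64 * ((χ * (8 * C * Real.exp δ)) * (8 * C' *
          Real.exp δ) * χ * Zl 4 (δ - θ) * Real.exp (-θ * l1 (P - P'))) + 64 * ((ψ * (8 * C * Real.exp δ)) * (8 * C' * Real.exp δ) * γ * Zl 4 (δ - θ) * Real.exp (-θ * l1 (P -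
          P')))) + (32 * ((χ * (8 * C * Real.exp δ)) * C' * (Real.exp θ * ψ) * Zl 4 (δ - θ) * Real.exp (-θ * l1 (P - P'))) + 32 * ((ψ * (8 * C * Real.exp δ)) * C' * (Real.exp θ
          * χ) * Zl 4 (δ - θ) * Real.exp (-θ * l1 (P - P'))))) + (64 * (χ * (8 * ((C * C') * Zl 4 (δ - θ) * Real.exp (-θ * l1 (P - P')))) * ψ + (χ * (8 * C * Real.exp δ)) * (8 *
          C' * Real.exp δ) * Zl 4 (δ - θ) * Real.exp (-θ * l1 (P - P')) * χ + (χ * (8 * C' * Real.exp δ)) * (8 * C * Real.exp δ) * Zl 4 (δ - θ) * Real.exp (-θ * l1 (P - P')) * χ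
          + ψ * (8 * ((C * C') * Zl 4 (δ - θ) * Real.exp (-θ * l1 (P - P')))) * χ) + 64 * (((χ * (8 * C * Real.exp δ)) * (8 * C' * Real.exp δ) * χ * Zl 4 (δ - θ) * Real.exp (-θ
          * l1 (P - P')) * ψ + (χ * (8 * C * Real.exp δ)) * (8 * C' * Real.exp δ) * ψ * Zl 4 (δ - θ) * Real.exp (-θ * l1 (P - P')) * χ) + ((ψ * (8 * C * Real.exp δ)) * (8 * C' *
          Real.exp δ) * γ * Zl 4 (δ - θ) * Real.exp (-θ * l1 (P - P')) * ψ + (ψ * (8 * C * Real.exp δ)) * (8 * C' * Real.exp δ) * χ * Zl 4 (δ - θ) * Real.exp (-θ * l1 (P - P'))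
          * χ)) + 64 * (((χ * (8 * C' * Real.exp δ)) * (8 * C * Real.exp δ) * χ * Zl 4 (δ - θ) * Real.exp (-θ * l1 (P - P')) * ψ + (χ * (8 * C' * Real.exp δ)) * (8 * C *
          Real.exp δ) * ψ * Zl 4 (δ - θ) * Real.exp (-θ * l1 (P - P')) * χ) + ((ψ * (8 * C' * Real.exp δ)) * (8 * C * Real.exp δ) * γ * Zl 4 (δ - θ) * Real.exp (-θ * l1 (P -
          P')) * ψ + (ψ * (8 * C' * Real.exp δ)) * (8 * C * Real.exp δ) * χ * Zl 4 (δ - θ) * Real.exp (-θ * l1 (P - P')) * χ))) + (64 * ((8 * C * Real.exp δ) * (8 * C' *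
          Real.exp δ) * γ * Zl 4 (δ - θ) * Real.exp (-θ * l1 (P - P'))) + 32 * ((8 * C * Real.exp δ) * C' * (Real.exp θ * χ) * Zl 4 (δ - θ) * Real.exp (-θ * l1 (P - P'))) + 32 *
          ((8 * C' * Real.exp δ) * C * (Real.exp θ * χ) * Zl 4 (δ - θ) * Real.exp (-θ * l1 (P - P'))) + 16 * (C * C' * (Real.exp θ * (Real.exp θ * r)) * Zl 4 (δ - θ) * Real.exp
          (-θ * l1 (P - P')))) + (64 * ((8 * C * Real.exp δ) * (8 * C' * Real.exp δ) * γ * Zl 4 (δ - θ) * Real.exp (-θ * l1 (P - P'))) + 32 * ((8 * C * Real.exp δ) * C' *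
          (Real.exp θ * χ) * Zl 4 (δ - θ) * Real.exp (-θ * l1 (P - P'))) + 32 * ((8 * C' * Real.exp δ) * C * (Real.exp θ * χ) * Zl 4 (δ - θ) * Real.exp (-θ * l1 (P - P'))) + 16
          * (C * C' * (Real.exp θ * (Real.exp θ * r)) * Zl 4 (δ - θ) * Real.exp (-θ * l1 (P - P')))) + ((64 * ((χ * (8 * C * Real.exp δ)) * (8 * C' * Real.exp δ) * χ * Zl 4 (δ -
          θ) * Real.exp (-θ * l1 (P - P'))) + 64 * ((ψ * (8 * C * Real.exp δ)) * (8 * C' * Real.exp δ) * γ * Zl 4 (δ - θ) * Real.exp (-θ * l1 (P - P')))) + (32 * ((χ * (8 * C *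
          Real.exp δ)) * C' * (Real.exp θ * ψ) * Zl 4 (δ - θ) * Real.exp (-θ * l1 (P - P'))) + 32 * ((ψ * (8 * C * Real.exp δ)) * C' * (Real.exp θ * χ) * Zl 4 (δ - θ) * Real.exp
          (-θ * l1 (P - P'))))) + ((64 * ((χ * (8 * C' * Real.exp δ)) * (8 * C * Real.exp δ) * χ * Zl 4 (δ - θ) * Real.exp (-θ * l1 (P - P'))) + 64 * ((ψ * (8 * C' * Real.exp
          δ)) * (8 * C * Real.exp δ) * γ * Zl 4 (δ - θ) * Real.exp (-θ * l1 (P - P')))) + (32 * ((χ * (8 * C' * Real.exp δ)) * C * (Real.exp θ * ψ) * Zl 4 (δ - θ) * Real.exp (-θ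
          * l1 (P - P'))) + 32 * ((ψ * (8 * C' * Real.exp δ)) * C * (Real.exp θ * χ) * Zl 4 (δ - θ) * Real.exp (-θ * l1 (P - P'))))) + (64 * (χ * (8 * ((C * C') * Zl 4 (δ - θ) *
          Real.exp (-θ * l1 (P - P'))))) + 32 * (χ * (8 * C * Real.exp δ) * Real.exp δ * C' * Zl 4 (δ - θ) * Real.exp (-θ * l1 (P - P'))) + 32 * (χ * (8 * C' * Real.exp δ) *
          Real.exp δ * C * Zl 4 (δ - θ) * Real.exp (-θ * l1 (P - P'))) + 32 * (r * ((C * C') * Zl 4 (δ - θ) * Real.exp (-θ * l1 (P - P'))))))) := by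
  have hR0 : ColMass (Rgt n a) 0 r := hR.2.mono hθ le_rfl
  have h9 := totMass_k9Inf hw hw' hθ hθδ ⟨hX.1.mono hθ le_rfl, hX.2.mono hθ le_rfl⟩ hR0
  have h5 := totMass_k5Inf hw hw' hθ hθδ hC.1 hX.2 hXt.1 hR.1
  have h7 := totMass_k7Inf hw hw' hθ hθδ hX hXt hC hY
  have h7' := totMass_k7Inf hw' hw hθ hθδ hX hXt hC hY
  have h4 := totMass_k4Inf hw hw' hθ hθδ hX hXt hC hY
  rw [l1_sub_symm] at h7'
  unfold cofPairInf
  exact totMass_smul (totMass_add (totMass_add (totMass_add (totMass_add (totMass_add (totMass_add (totMass_add (totMass_add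
    (totMass_trK h9) (totMass_trK h7')) (totMass_trK h7)) h4) h5) (totMass_trK h5)) h7) h7') h9) 2

end Total

end Summit.QuantumFields.BalabanUV.Beta.D1BFx.CoframeWordsKfour

end
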